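import Summits.QuantumFields.YangMills.Theorems.BalabanUVNodesN12DirectChartPackageOfClassL1

/-!
# DAG node N12 [B15] — THE ℓ¹ LETTERS' INHABITANTS OF RECORD AND THE FAMILY FORM OF THE ℓ¹-CURRENCY CHART HALF (sequel of `N12DirectChartPackageOfClassL1`, split for the
# 400-line lint; uniformity pen ρ6, census §7 U2b at the consumer)

Cell `pub-ymgap`, HUMAN RULINGS D-0062 ∕ D-0149, lane owner `pub-ymgap-dag-n12-c` (g22).  Key K1⁹ `stmt-QuantumFields-27364`, `--kind proof --supports … --as helper`; count-neutral.
NEW leaf; CONSUMED BY NAME: `N12DirectChartPackageOfClassL1.sum_opNorm_le_sqrt_natCard_mul_sqrt_of_support` (§0) and `…exists_hWD_chartHalf_of_class_uniform_l1` (§2).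

THIS FILE.
* §1 inhabitants of record TODAY of the two ℓ¹ letters of the parent: `pi_norm_le_sum_norm`, `pi_norm_sq_le_sum_norm_sq` (sup vs ℓ¹ ∕ ℓ² on a finite product);
  ★★ `hHB1_of_hHB` — for ANY `H` with the ℓ² letter `√(Σ_b ‖(H v)_b‖²) ≤ B‖v‖`, `0 ≤ B` (dag-n12-w6's (P4)′ letter p664681 ∕ p678596), the ℓ¹ → ℓ¹ output letter holds at
  `B₁ := √#{b | b.src ∈ maxDomT M₁ Z 1} · B`; `hB1_nonneg`; ★★ `exists_hHB1_of_exists_hHB` — the same under the `∃ B, 0 ≤ B ∧ ∀ W U₀, Q W U₀ → ∃ H, R W U₀ H ∧ …` shape of a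
  right-inverse letter family; `sum_opNorm_le_natCard_mul_norm_of_support` + ★★ `hHB1_of_hSup` — `B₁ := #{b | b.src ∈ maxDomT M₁ Z 1}·B` from a SUP-NORM letter `‖H v‖ ≤ B‖v‖`
  (dag-n12-w6's graded support edition exports one); ★★ `hM₂1_of_hM₂` — the ℓ¹-curvature letter at `#constraints · M₂` from a sup-curvature letter `‖Ψ w‖ ≤ M₂‖w‖²`
  (`N12ChartCurvatureOfClass.norm_fderiv_fderiv_msChart_le_of_class` ∕ `Node00.exists_uniform_chartCurvature_sq_bound`).
* §2 ★★ `exists_hWD_chartHalf_of_class_uniform_l1_family` — constant FAMILIES `C ρ K_τ ρ_τ ρ″ : ι → ℝ` by `choose`, and for every `i` the ∀-body of §2 of the parent at height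
  `k i`: the one-line discharge of the ℓ¹-currency chart-half letter BEFORE `ν` is fixed.

HONEST FRAMING.  Cauchy–Schwarz, counting, one `choose`; today's `B₁` and `M₂` inhabitants carry large-field-region counts (`√#` ∕ `#{b | b.src ∈ Ω₁(Z)}`, `#constraints`) — no
longer the torus volume in `B₁`, and NOT print's volume-free numbers; volume-free inhabitants are NOT claimed; nothing of Bałaban's asserted; count-neutral helper; N12 NOT
discharged; K1⁹ NOT closed; counts unmoved; one finite 𝕋⁴ programme at fixed ε — R4 closes the conditional finite-𝕋⁴ rung `BalabanLadder.UV` only; NOT continuum ∕ OS ∕ mass gap ∕ Clay.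
[Balaban1989LargeFieldII] p. 357, (1.7) p. 358, (1.12)–(1.13) p. 359; [Balaban1985Variational] (45)–(46) p. 285, (81)–(83) p. 290; [Balaban1988Convergent] (2.2) p. 255, (2.10)–(2.13) pp. 256–257.
-/

noncomputable section
open scoped BigOperators Matrix.Norms.L2Operator Topology
open Filter Finset

namespace Summit.QuantumFields.YangMills.BalabanUVNodes.N12DirectChartPackageOfClassL1Family

open Literature.MathematicalPhysics.QuantumFieldTheory.Balaban1983to89
open Literature.MathematicalPhysics.QuantumLattice (quatMatrix)
open T4Continuum (T4Family)
open T4HaarSU2ExpChart (imQuat)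
open T4AdjointCovarianceUnitary (lieSU)
open T4CubeChartGnomonic (SU2)
open B15DeterminingSets GaugeField
open B14.Eq213DetSet (Bj Bj_of_gt maxDomT)
open B14.Eq216Concrete (feeds)
open B15Prop1SliceCoordinates (GaugeSlice ιA)
open B15Prop1ChartCalculusSU2 (E3)
open B15Prop1ChartSU2 (su2Chart)
open B16Sect1Backgrounds (expMul)
open T4AxialGaugeSmallField (castSite)
open B6TreeGaugePoincare (curl)
open B16Eq18Proof (box)
open LatticeFieldCalculus (runSite)
open BlockAveragingEMLLinearised (linAvg)
open Literature.MathematicalPhysics.QuantumFieldTheory.BalabanImbrieJaffe1984to88.BIJ85Eq453GaugeField (qsstarGIter0)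
open Node00
open B16Ineq19FlatSliceChart (exists_lieSU2Coord)
open Summit.QuantumFields.YangMills.BalabanUVNodes.N12NearFlatChartLetter (sum_opNorm_sq_le_l2Seminorm_sq l2Seminorm_le_of_bound_of_support
  l2Seminorm_le_sqrt_card_mul_norm sum_opNorm_le_sqrt_card_mul_l2Seminorm l2Seminorm_apply)
open Summit.QuantumFields.YangMills.BalabanUVNodes.N12RightInverseLevelZeroLocality (mem_bondsOf_Bj_zero)
open B16Ineq17NearFlatWilsonLetters (fderiv_wilsonAction4_expChart_apply_eq_deriv)
open Summit.QuantumFields.YangMills.BalabanUVNodes.N12NearFlatFederbushFibreRecord (hcons_of_plaqsInside_maxDomT)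
open Summit.QuantumFields.YangMills.BalabanUVNodes.N12NearFlatFederbushFibreWindowKnit (runSite_runSite_blockSite_mem_tower)
open Summit.QuantumFields.YangMills.BalabanUVNodes.N12NearFlatFederbushVelocityWindow (exists_hmX_federbush_window_of_isMinimizer_family)
open Summit.QuantumFields.YangMills.BalabanUVNodes.N12DirectChartLetterCore (exists_twistSize_of_nearFlat_feeds abs_fderiv_wilsonAction4_expChart_apply_le_of_plaqSmall norm_le_sqrt_sum_sq)
open Summit.QuantumFields.YangMills.BalabanUVNodes.N12DirectChartLetterHSupportVacuity (hHsupp_levelZeroFree_of_rightInverse fderiv_fderiv_msChart_levelZeroFree_direct)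
open Summit.QuantumFields.YangMills.BalabanUVNodes.N12NearFlatFederbushVelocityWindow (hmX_federbush_window_of_delta2Component)
open Summit.QuantumFields.YangMills.BalabanUVNodes.N12NearFlatDelta2LetterComponent (exists_delta2_letter_component)
open Summit.QuantumFields.YangMills.BalabanUVNodes.N12DirectChartLetterHSupportVacuity (rightInverse_apply_levelZero)
open Summit.QuantumFields.YangMills.BalabanUVNodes.N12TowerProxiesOfClass (chartLetters_msChart_Bj_of_isMinimizer_of_class exists_lam_msChart_Bj_of_isMinimizer_regMSCoPOfRecord_of_class)
open B14.Eq213MaximalDomains (side)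
open B16Ineq19NearFlatSliceNorms (opNorm_coe_le_norm_lieSU)
open Summit.QuantumFields.YangMills.BalabanUVNodes.N12DirectChartPackageOfClassL1 (sum_opNorm_le_sqrt_natCard_mul_sqrt_of_support exists_hWD_chartHalf_of_class_uniform_l1)

variable {F : T4Family}

/-! ## §1  Today's inhabitants of the two ℓ¹ letters -/

section Inhabitant

/-- `‖v‖ ≤ Σ_c ‖v_c‖` for the sup norm of a finite product. [cite: Balaban1985Averaging, (17)–(19) pp.20–21 (bookkeeping)] -/
theorem pi_norm_le_sum_norm {ι : Type*} [Fintype ι] {E : Type*} [SeminormedAddCommGroup E] (v : ι → E) : ‖v‖ ≤ ∑ c, ‖v c‖ :=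
  (pi_norm_le_iff_of_nonneg (Finset.sum_nonneg fun c _ => norm_nonneg (v c))).2 fun c =>
    Finset.single_le_sum (f := fun c => ‖v c‖) (fun c _ => norm_nonneg (v c)) (Finset.mem_univ c)

/-- `‖w‖² ≤ Σ_b ‖w_b‖²` for the sup norm of a finite product. [cite: Balaban1985Averaging, (17)–(19) pp.20–21 (bookkeeping)] -/
theorem pi_norm_sq_le_sum_norm_sq {ι : Type*} [Fintype ι] {E : Type*} [SeminormedAddCommGroup E] (w : ι → E) : ‖w‖ ^ 2 ≤ ∑ b, ‖w b‖ ^ 2 := by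
  have h : ‖w‖ ≤ Real.sqrt (∑ b, ‖w b‖ ^ 2) :=
    (pi_norm_le_iff_of_nonneg (Real.sqrt_nonneg _)).2 fun b =>
      Real.le_sqrt_of_sq_le (Finset.single_le_sum (f := fun b => ‖w b‖ ^ 2) (fun b _ => sq_nonneg _) (Finset.mem_univ b))
  calc ‖w‖ ^ 2 ≤ Real.sqrt (∑ b, ‖w b‖ ^ 2) ^ 2 := pow_le_pow_left₀ (norm_nonneg _) h 2
    _ = ∑ b, ‖w b‖ ^ 2 := Real.sq_sqrt (Finset.sum_nonneg fun b _ => sq_nonneg _)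

/-- ★★ **TODAY's INHABITANT OF THE ℓ¹ → ℓ¹ OUTPUT LETTER `hHB1` FROM THE ℓ² LETTER.**  For any map `H` into level-0 bond fields carrying the ℓ² letter `√(Σ_b ‖(H v)_b‖²) ≤ B‖v‖`,
`0 ≤ B` (dag-n12-w6's (P4)′ letter, p664681 ∕ p678596): if `H v` vanishes off the bonds sourced in `maxDomT M₁ Z 1`, then `Σ_b ‖↑(H v)_b‖_op ≤ (√#{b | b.src ∈ maxDomT M₁ Z 1}·B)·Σ_c ‖v_c‖`
(Cauchy–Schwarz on the support, `N12DirectChartPackageOfClassL1` §0, and `‖v‖ ≤ Σ_c ‖v_c‖`).  The explicit factor is the LARGE-FIELD REGION's bond count, no longer the torus volume; a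
volume-free `B₁` is not claimed. [cite: Balaban1989LargeFieldII, (1.13) p.359; Balaban1985Variational, (45)–(46) p.285 (bookkeeping)] -/
theorem hHB1_of_hHB {P : Params} {ι : Type*} [Fintype ι] (M₁ : ℕ) (Z : Set (Site P 0))
    (H : (ι → lieSU (Fin 2)) → PBond P 0 → lieSU (Fin 2)) {B : ℝ} (hB0 : 0 ≤ B) (hHB : ∀ v, Real.sqrt (∑ b, ‖H v b‖ ^ 2) ≤ B * ‖v‖) :
    ∀ v, (∀ b : PBond P 0, b.src ∉ maxDomT M₁ Z 1 → H v b = 0) →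
      ∑ b, ‖(H v b : Matrix (Fin 2) (Fin 2) ℂ)‖ ≤ (Real.sqrt (Nat.card {b : PBond P 0 // b.src ∈ maxDomT M₁ Z 1}) * B) * ∑ c, ‖v c‖ := by
  intro v hv
  calc ∑ b, ‖(H v b : Matrix (Fin 2) (Fin 2) ℂ)‖
      ≤ Real.sqrt (Nat.card {b : PBond P 0 // b.src ∈ maxDomT M₁ Z 1}) * Real.sqrt (∑ b, ‖H v b‖ ^ 2) :=
        sum_opNorm_le_sqrt_natCard_mul_sqrt_of_support (maxDomT M₁ Z 1) (H v) hv
    _ ≤ Real.sqrt (Nat.card {b : PBond P 0 // b.src ∈ maxDomT M₁ Z 1}) * (B * ∑ c, ‖v c‖) :=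
        mul_le_mul_of_nonneg_left ((hHB v).trans (mul_le_mul_of_nonneg_left (pi_norm_le_sum_norm v) hB0)) (Real.sqrt_nonneg _)
    _ = (Real.sqrt (Nat.card {b : PBond P 0 // b.src ∈ maxDomT M₁ Z 1}) * B) * ∑ c, ‖v c‖ := by ring

/-- The sign of today's constant: `0 ≤ √#{b | b.src ∈ maxDomT M₁ Z 1} · B` for `0 ≤ B`. [cite: Balaban1985Variational, (45)–(46) p.285 (bookkeeping)] -/
theorem hB1_nonneg {P : Params} (M₁ : ℕ) (Z : Set (Site P 0)) {B : ℝ} (hB0 : 0 ≤ B) :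
    0 ≤ Real.sqrt (Nat.card {b : PBond P 0 // b.src ∈ maxDomT M₁ Z 1}) * B := mul_nonneg (Real.sqrt_nonneg _) hB0

/-- ★★ **RE-KEYING A RIGHT-INVERSE LETTER FAMILY TO ℓ¹ CURRENCY.**  A right-inverse letter of the shape `∃ B, 0 ≤ B ∧ ∀ W U₀, Q W U₀ → ∃ H, R W U₀ H ∧ (ℓ² letter at B)` (the
shape of dag-n12-w6's `exists_rightInverse_letter(_of_proxies)` ∀-bodies once `(M₁, Z)` is fixed; `Q` = its premises, `R` = the right-inverse identity, generic here) yields the same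
with the ℓ¹ → ℓ¹ output letter at `B₁ = √#{b | b.src ∈ maxDomT M₁ Z 1}·B`. [cite: Balaban1985Variational, (45)–(46) p.285; Balaban1989LargeFieldII, (1.13) p.359 (bookkeeping)] -/
theorem exists_hHB1_of_exists_hHB {P : Params} {ι : Type*} [Fintype ι] (M₁ : ℕ) (Z : Set (Site P 0)) {α β : Type*}
    (Q : α → β → Prop) (R : α → β → ((ι → lieSU (Fin 2)) → PBond P 0 → lieSU (Fin 2)) → Prop)
    (h : ∃ B : ℝ, 0 ≤ B ∧ ∀ (W : α) (U₀ : β), Q W U₀ →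
      ∃ H : (ι → lieSU (Fin 2)) → PBond P 0 → lieSU (Fin 2), R W U₀ H ∧ ∀ v, Real.sqrt (∑ b, ‖H v b‖ ^ 2) ≤ B * ‖v‖) :
    ∃ B₁ : ℝ, 0 ≤ B₁ ∧ ∀ (W : α) (U₀ : β), Q W U₀ →
      ∃ H : (ι → lieSU (Fin 2)) → PBond P 0 → lieSU (Fin 2), R W U₀ H ∧
        ∀ v, (∀ b : PBond P 0, b.src ∉ maxDomT M₁ Z 1 → H v b = 0) → ∑ b, ‖(H v b : Matrix (Fin 2) (Fin 2) ℂ)‖ ≤ B₁ * ∑ c, ‖v c‖ := by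
  obtain ⟨B, hB0, hH⟩ := h
  refine ⟨Real.sqrt (Nat.card {b : PBond P 0 // b.src ∈ maxDomT M₁ Z 1}) * B, hB1_nonneg M₁ Z hB0, fun W U₀ hQ => ?_⟩
  obtain ⟨H, hR, hHB⟩ := hH W U₀ hQ
  exact ⟨H, hR, hHB1_of_hHB M₁ Z H hB0 hHB⟩

/-- **ℓ¹(op) against the SUP NORM ON THE SUPPORT.**  If `Y` vanishes off the bonds sourced in `S`, then `Σ_b ‖↑Y_b‖_op ≤ #{b | b.src ∈ S} · ‖Y‖` — the passage from a SUP-NORM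
letter of a right inverse (dag-n12-w6's graded support edition exports `‖H v‖ ≤ B‖v‖`) to the ℓ¹ output letter at `B₁ = #{b | b.src ∈ Ω₁(Z)}·B`.
[cite: Balaban1989LargeFieldII, (1.13) p.359; Balaban1985Averaging, (17)–(19) pp.20–21 (bookkeeping)] -/
theorem sum_opNorm_le_natCard_mul_norm_of_support {N : ℕ} [NeZero N] {P : Params} {j : ℕ} (S : Set (Site P j)) (Y : PBond P j → lieSU (Fin N))
    (hs : ∀ b : PBond P j, b.src ∉ S → Y b = 0) :
    ∑ b, ‖(Y b : Matrix (Fin N) (Fin N) ℂ)‖ ≤ (Nat.card {b : PBond P j // b.src ∈ S}) * ‖Y‖ := by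
  classical
  have hsplit : ∑ b, ‖(Y b : Matrix (Fin N) (Fin N) ℂ)‖ = ∑ b ∈ Finset.univ.filter (fun b : PBond P j => b.src ∈ S), ‖(Y b : Matrix (Fin N) (Fin N) ℂ)‖ := by
    rw [Finset.sum_filter]
    refine Finset.sum_congr rfl fun b _ => ?_
    split_ifs with h
    · rfl
    · rw [hs b h]; simp
  have hcard : ((Finset.univ.filter (fun b : PBond P j => b.src ∈ S)).card : ℝ) = (Nat.card {b : PBond P j // b.src ∈ S} : ℝ) := by
    rw [Nat.card_eq_fintype_card, Fintype.card_subtype]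
  rw [hsplit, ← hcard]
  calc ∑ b ∈ Finset.univ.filter (fun b : PBond P j => b.src ∈ S), ‖(Y b : Matrix (Fin N) (Fin N) ℂ)‖
      ≤ ∑ _b ∈ Finset.univ.filter (fun b : PBond P j => b.src ∈ S), ‖Y‖ :=
        Finset.sum_le_sum fun b _ => (opNorm_coe_le_norm_lieSU (Y b)).trans (norm_le_pi_norm Y b)
    _ = ((Finset.univ.filter (fun b : PBond P j => b.src ∈ S)).card : ℝ) * ‖Y‖ := by rw [Finset.sum_const, nsmul_eq_mul]

/-- ★★ **THE INHABITANT OF `hHB1` FROM A SUP-NORM LETTER.**  For any map `H` into level-0 bond fields with the sup-norm letter `‖H v‖ ≤ B‖v‖`, `0 ≤ B` (dag-n12-w6's graded support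
edition), the ℓ¹ → ℓ¹ output letter holds at `B₁ := #{b | b.src ∈ maxDomT M₁ Z 1} · B`. [cite: Balaban1989LargeFieldII, (1.13) p.359; Balaban1985Variational, (45)–(46) p.285 (bookkeeping)] -/
theorem hHB1_of_hSup {P : Params} {ι : Type*} [Fintype ι] (M₁ : ℕ) (Z : Set (Site P 0))
    (H : (ι → lieSU (Fin 2)) → PBond P 0 → lieSU (Fin 2)) {B : ℝ} (hB0 : 0 ≤ B) (hHsup : ∀ v, ‖H v‖ ≤ B * ‖v‖) :
    ∀ v, (∀ b : PBond P 0, b.src ∉ maxDomT M₁ Z 1 → H v b = 0) →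
      ∑ b, ‖(H v b : Matrix (Fin 2) (Fin 2) ℂ)‖ ≤ ((Nat.card {b : PBond P 0 // b.src ∈ maxDomT M₁ Z 1}) * B) * ∑ c, ‖v c‖ := by
  intro v hv
  calc ∑ b, ‖(H v b : Matrix (Fin 2) (Fin 2) ℂ)‖
      ≤ (Nat.card {b : PBond P 0 // b.src ∈ maxDomT M₁ Z 1}) * ‖H v‖ := sum_opNorm_le_natCard_mul_norm_of_support (maxDomT M₁ Z 1) (H v) hv
    _ ≤ (Nat.card {b : PBond P 0 // b.src ∈ maxDomT M₁ Z 1}) * (B * ∑ c, ‖v c‖) :=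
        mul_le_mul_of_nonneg_left ((hHsup v).trans (mul_le_mul_of_nonneg_left (pi_norm_le_sum_norm v) hB0)) (Nat.cast_nonneg _)
    _ = ((Nat.card {b : PBond P 0 // b.src ∈ maxDomT M₁ Z 1}) * B) * ∑ c, ‖v c‖ := by ring

/-- ★★ **TODAY's INHABITANT OF THE ℓ¹-CURVATURE LETTER `hM₂1` FROM A SUP-CURVATURE LETTER.**  For any `Ψ : (κ → 𝔰𝔲(N)) → (ι → 𝔰𝔲(N))` with `‖Ψ w‖ ≤ M₂‖w‖²`, `0 ≤ M₂` (the shape of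
`N12ChartCurvatureOfClass.norm_fderiv_fderiv_msChart_le_of_class` ∕ `Node00.exists_uniform_chartCurvature_sq_bound` at `Ψ w := D²Ψ_{U₀}(0)(w,w)`):
`Σ_c ‖(Ψ w)_c‖ ≤ (#ι · M₂) · Σ_b ‖w_b‖²`.  The explicit factor `#ι` = the number of constraint coordinates (a large-field-region count); a volume-free constant (component-local
curvature + the finite overlap of `feeds`, per height) is NOT claimed here. [cite: Balaban1985Variational, (81)–(83) p.290; Balaban1989LargeFieldII, (1.12) p.359 (bookkeeping)] -/
theorem hM₂1_of_hM₂ {ι κ : Type*} [Fintype ι] [Fintype κ] {N : ℕ} (Ψ : (κ → lieSU (Fin N)) → (ι → lieSU (Fin N))) {M₂ : ℝ} (hM₂0 : 0 ≤ M₂)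
    (h : ∀ w, ‖Ψ w‖ ≤ M₂ * ‖w‖ ^ 2) :
    ∀ w, ∑ c, ‖Ψ w c‖ ≤ ((Fintype.card ι : ℝ) * M₂) * ∑ b, ‖w b‖ ^ 2 := by
  intro w
  calc ∑ c, ‖Ψ w c‖ ≤ ∑ _c : ι, ‖Ψ w‖ := Finset.sum_le_sum fun c _ => norm_le_pi_norm (Ψ w) c
    _ = (Fintype.card ι : ℝ) * ‖Ψ w‖ := by rw [Finset.sum_const, Finset.card_univ, nsmul_eq_mul]
    _ ≤ (Fintype.card ι : ℝ) * (M₂ * ∑ b, ‖w b‖ ^ 2) :=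
        mul_le_mul_of_nonneg_left ((h w).trans (mul_le_mul_of_nonneg_left (pi_norm_sq_le_sum_norm_sq w) hM₂0)) (Nat.cast_nonneg _)
    _ = ((Fintype.card ι : ℝ) * M₂) * ∑ b, ‖w b‖ ^ 2 := by ring

end Inhabitant

/-! ## §2  The family form of the ℓ¹-currency chart half -/

/-- ★★ **THE FAMILY FORM — the consumer's one-liner** for the ℓ¹-currency edition: constant FAMILIES `C ρ K_τ ρ_τ ρ″ : ι → ℝ` (by `choose`, one 5-tuple per height) with the
signs and, for every `i`, the ∀-body of `N12DirectChartPackageOfClassL1.exists_hWD_chartHalf_of_class_uniform_l1` at height `k i` — the chart-half letter in which the right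
inverse enters through the ℓ¹ → ℓ¹ output letter, the curvature through the ℓ¹-curvature letter, and the (μ) constant is `2(d−1)·ε_P·B₁·M₂`; discharged BEFORE `ν` is fixed.
[cite: Balaban1989LargeFieldII, p.357, (1.7) p.358, (1.12)–(1.13) p.359; Balaban1985Variational, (45) p.285, (81)–(83) p.290; Balaban1988Convergent, (2.2) p.255, (2.10)–(2.13) pp.256–257] -/
theorem exists_hWD_chartHalf_of_class_uniform_l1_family (Kt : ℕ) (h0 : 0 < (F.P Kt).d) {ι : Type*} (k : ι → ℕ) (hk0 : ∀ i, 0 < k i)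
    (hk : ∀ i, k i ≤ (F.P Kt).m + (F.P Kt).K) :
    ∃ C ρ Kτ ρτ ρ'' : ι → ℝ, (∀ i, 0 ≤ C i) ∧ (∀ i, 0 < ρ i) ∧ (∀ i, 0 ≤ Kτ i) ∧ (∀ i, 0 < ρτ i) ∧ (∀ i, 0 < ρ'' i) ∧ ∀ i,
        ∀ (ν : Node00.Stage7Numerics) (Z Λ : Set (Site (F.P Kt) 0)) (T : Finset (PBond (F.P Kt) (k i))) (lo hi : Fin (F.P Kt).d → ℤ),
        (∀ κ, ((((hi κ - lo κ + 1).toNat + 3 : ℕ) : ℤ)) ≤ (F.P Kt).sitesPerDir (k i)) →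
        (∀ (ν' : Fin (F.P Kt).d), ∀ z ∈ box (fun κ => (hi κ - lo κ + 1).toNat + 3) (fun κ => lo κ - 2),
          (castSite z : Site (F.P Kt) (k i)) ∈ pts (k i) (maxDomT ν.M₁ Z (k i)) ∧ (castSite z : Site (F.P Kt) (k i)).shift ⟨0, h0⟩ ∈ pts (k i) (maxDomT ν.M₁ Z (k i)) ∧
            (castSite z : Site (F.P Kt) (k i)).shift ν' ∈ pts (k i) (maxDomT ν.M₁ Z (k i))) →
        (k i) + 1 ≤ (F.P Kt).m + (F.P Kt).K → 4 * (F.P Kt).L ≤ ν.M₁ → side (F.P Kt).L ν.M₁ (k i) ∣ (F.P Kt).sitesPerDir 0 → 0 ≤ ν.εreg →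
        6 * ((((F.P Kt).d - 1 : ℕ)) : ℝ) * (F.P Kt).L * ν.εreg ≤ (ρ'' i) →
        ∀ (ext : GaugeField (F.P Kt) (k i) SU2 → GaugeField (F.P Kt) (k i) SU2) (Vk : GaugeField (F.P Kt) (k i) SU2) ⦃R 𝓐₀ : ℝ⦄, 0 < R → 0 ≤ 𝓐₀ →
        ∀ (U₀ : GaugeField (F.P Kt) 0 SU2) (Xf : GaugeSlice (pts (k i) Λ) T E3 → PBond (F.P Kt) 0 → lieSU (Fin 2)),
        IsMinimizer (Node00.avOfRecord F 2 Kt) (Node00.regMSCoPOfRecord F 2 ν Kt (k i) (maxDomT ν.M₁ Z)) (Bj ν.M₁ Z (k i))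
          (avgFamily (Node00.avOfRecord F 2 Kt) (qsstarGIter0 (k i) (ext Vk))) U₀ →
        ∀ ⦃εP : ℝ⦄, 0 ≤ εP →
        (∀ p : Plaq (F.P Kt) 0, ((⟨p.src, p.μ⟩ : PBond (F.P Kt) 0) ∈ {b : PBond (F.P Kt) 0 | b.src ∈ maxDomT ν.M₁ Z 1} ∨
            (⟨p.src.shift p.μ, p.ν⟩ : PBond (F.P Kt) 0) ∈ {b : PBond (F.P Kt) 0 | b.src ∈ maxDomT ν.M₁ Z 1} ∨
            (⟨p.src.shift p.ν, p.μ⟩ : PBond (F.P Kt) 0) ∈ {b : PBond (F.P Kt) 0 | b.src ∈ maxDomT ν.M₁ Z 1} ∨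
            (⟨p.src, p.ν⟩ : PBond (F.P Kt) 0) ∈ {b : PBond (F.P Kt) 0 | b.src ∈ maxDomT ν.M₁ Z 1}) →
          ‖((GaugeField.plaqHol U₀ p : SU2) : Matrix (Fin 2) (Fin 2) ℂ) - 1‖ ≤ εP) →
        ∀ (H : (Fin (constrCard (Bj ν.M₁ Z (k i)) (k i)) → lieSU (Fin 2)) → PBond (F.P Kt) 0 → lieSU (Fin 2)) ⦃B₁ : ℝ⦄, 0 ≤ B₁ →
        (∀ v, fderiv ℝ (msChart F 2 Kt (k i) (Bj ν.M₁ Z (k i)) (avgFamily (avOfRecord F 2 Kt) (qsstarGIter0 (k i) (ext Vk))) U₀) 0 (H v) = v) →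
        (∀ v, (∀ b : PBond (F.P Kt) 0, b.src ∉ maxDomT ν.M₁ Z 1 → H v b = 0) → ∑ b, ‖(H v b : Matrix (Fin 2) (Fin 2) ℂ)‖ ≤ B₁ * ∑ c, ‖v c‖) →
        ∀ ⦃M₂ : ℝ⦄, (∀ w, ∑ c, ‖fderiv ℝ (fderiv ℝ (msChart F 2 Kt (k i) (Bj ν.M₁ Z (k i)) (avgFamily (avOfRecord F 2 Kt) (qsstarGIter0 (k i) (ext Vk))) U₀)) 0 w w c‖ ≤ M₂ * ∑ b, ‖w b‖ ^ 2) →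
        Xf 0 = 0 → ContDiffAt ℝ 2 Xf 0 →
        (∀ᶠ Y in 𝓝 (0 : GaugeSlice (pts (k i) Λ) T E3),
          IsMinimizer (Node00.avOfRecord F 2 Kt) (Node00.regMSCoPOfRecord F 2 ν Kt (k i) (maxDomT ν.M₁ Z)) (Bj ν.M₁ Z (k i))
            (avgFamily (Node00.avOfRecord F 2 Kt) (qsstarGIter0 (k i) (expMul su2Chart (ιA (pts (k i) Λ) T Y) (ext Vk)))) (expChart U₀ (Xf Y))) →
        (∀ (X : GaugeSlice (pts (k i) Λ) T E3) (b : PBond (F.P Kt) 0),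
          ‖((fderiv ℝ Xf 0 X b : lieSU (Fin 2)) : Matrix (Fin 2) (Fin 2) ℂ)‖ ≤ 8 * 𝓐₀ / R * ‖X‖ ∧ ‖fderiv ℝ Xf 0 X b‖ ≤ 12 * 𝓐₀ / R * ‖X‖) →
        (∀ (X : GaugeSlice (pts (k i) Λ) T E3) (b : PBond (F.P Kt) 0), b.src ∉ maxDomT ν.M₁ Z 1 → fderiv ℝ Xf 0 X b = 0) →
        ∀ (W : Finset (Plaq (F.P Kt) 0)),
        (∀ q : Plaq (F.P Kt) 0, q.src ∈ ((box (fun κ => (F.P Kt).L ^ (k i) * ((hi κ - lo κ + 1).toNat + 3 + 1) - 1) (fun κ => ((F.P Kt).L : ℤ) ^ (k i) * (lo κ - 2))).image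
            (fun z => (castSite z : Site (F.P Kt) 0))) → q ∈ W) →
        ∀ ⦃δW : ℝ⦄, 0 < δW → δW < (ρ i) → δW < (ρτ i) →
        (∀ (ν' : Fin (F.P Kt).d), ∀ z ∈ box (fun κ => (hi κ - lo κ + 1).toNat + 3) (fun κ => lo κ - 2), ∀ b₀ : PBond (F.P Kt) 0,
          (b₀ ∈ feeds (k i) (⟨(castSite z : Site (F.P Kt) (k i)), ⟨0, h0⟩⟩ : PBond (F.P Kt) (k i)) ∨ b₀ ∈ feeds (k i) (⟨((castSite z : Site (F.P Kt) (k i))).shift ⟨0, h0⟩, ν'⟩ : PBond (F.P Kt) (k i))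
          ∨ b₀ ∈ feeds (k i) (⟨((castSite z : Site (F.P Kt) (k i))).shift ν', ⟨0, h0⟩⟩ : PBond (F.P Kt) (k i)) ∨ b₀ ∈ feeds (k i) (⟨(castSite z : Site (F.P Kt) (k i)), ν'⟩ : PBond (F.P Kt) (k i))) →
          ‖((U₀ b₀ : SU2) : Matrix (Fin 2) (Fin 2) ℂ) - 1‖ ≤ δW) →
        ∃ (Ψ₂ : (PBond (F.P Kt) 0 → lieSU (Fin 2)) →L[ℝ] (PBond (F.P Kt) 0 → lieSU (Fin 2)) →L[ℝ] (Fin (constrCard (Bj ν.M₁ Z (k i)) (k i)) → lieSU (Fin 2)))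
          (lam : (Fin (constrCard (Bj ν.M₁ Z (k i)) (k i)) → lieSU (Fin 2)) →L[ℝ] ℝ)
          (p : Seminorm ℝ (PBond (F.P Kt) 0 → lieSU (Fin 2))),
          HasFDerivAt (fun Y => fderiv ℝ (msChart F 2 Kt (k i) (Bj ν.M₁ Z (k i)) (avgFamily (avOfRecord F 2 Kt) (qsstarGIter0 (k i) (ext Vk))) U₀) Y) Ψ₂ 0 ∧
          (∀ᶠ Y in 𝓝 (0 : PBond (F.P Kt) 0 → lieSU (Fin 2)), DifferentiableAt ℝ (msChart F 2 Kt (k i) (Bj ν.M₁ Z (k i)) (avgFamily (avOfRecord F 2 Kt) (qsstarGIter0 (k i) (ext Vk))) U₀) Y) ∧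
          fderiv ℝ (fun Y : PBond (F.P Kt) 0 → lieSU (Fin 2) => wilsonAction4 (expChart U₀ Y)) 0 = lam.comp (fderiv ℝ (msChart F 2 Kt (k i) (Bj ν.M₁ Z (k i)) (avgFamily (avOfRecord F 2 Kt) (qsstarGIter0 (k i) (ext Vk))) U₀) 0) ∧
          (∀ Y : PBond (F.P Kt) 0 → lieSU (Fin 2), ∑ b, ‖(Y b : Matrix (Fin 2) (Fin 2) ℂ)‖ ^ 2 ≤ p Y ^ 2) ∧
          ∀ X : GaugeSlice (pts (k i) Λ) T E3,
            lam (Ψ₂ (fderiv ℝ Xf 0 X) (fderiv ℝ Xf 0 X))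
                ≤ (2 * (((F.P Kt).d : ℝ) - 1) * εP * B₁ * M₂) * p (fderiv ℝ Xf 0 X) ^ 2 ∧
            p (fderiv ℝ Xf 0 X) ≤ (12 * 𝓐₀ / R * Real.sqrt (Nat.card {b : PBond (F.P Kt) 0 // b.src ∈ maxDomT ν.M₁ Z 1})) * ‖X‖ ∧
            (((F.P Kt).L : ℝ) ^ (F.P Kt).d) ^ (k i) / ((((F.P Kt).L : ℝ)) ^ 2 * ((F.P Kt).L : ℝ) ^ 2) ^ (k i) / 2 * (∑ z ∈ box (fun κ => (hi κ - lo κ + 1).toNat + 3) (fun κ => lo κ - 2), ∑ μ : Fin (F.P Kt).d, ∑ a : Fin 3, curl (fun b => ιA (pts (k i) Λ) T X (⟨castSite b.1, b.2⟩ : PBond (F.P Kt) (k i)) a) z ⟨0, h0⟩ μ ^ 2)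
                - (((F.P Kt).L : ℝ) ^ (F.P Kt).d) ^ (k i) / ((((F.P Kt).L : ℝ)) ^ 2 * ((F.P Kt).L : ℝ) ^ 2) ^ (k i) * (8 * (((F.P Kt).d : ℝ) + 1) * (2 * ((Kτ i) + 1) * δW) + 8 * ((F.P Kt).d : ℝ) * (((box (fun κ => (hi κ - lo κ + 1).toNat + 3) (fun κ => lo κ - 2)).image (fun z => (castSite z : Site (F.P Kt) (k i)))).card : ℝ) * ((C i) * δW * (12 * 𝓐₀ / R * Real.sqrt (Nat.card {b : PBond (F.P Kt) 0 // b.src ∈ maxDomT ν.M₁ Z 1}))) ^ 2) * ‖X‖ ^ 2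
              ≤ ((Fintype.card (Fin 2) : ℝ)⁻¹ • ∑ p ∈ W, (innerSL ℝ (E := lieSU (Fin 2))).bilinearComp
                (ContinuousLinearMap.proj (R := ℝ) (φ := fun _ : PBond (F.P Kt) 0 => lieSU (Fin 2)) (⟨p.src, p.μ⟩ : PBond (F.P Kt) 0) + ContinuousLinearMap.proj (R := ℝ) (φ := fun _ : PBond (F.P Kt) 0 => lieSU (Fin 2)) (⟨p.src.shift p.μ, p.ν⟩ : PBond (F.P Kt) 0)
                  - ContinuousLinearMap.proj (R := ℝ) (φ := fun _ : PBond (F.P Kt) 0 => lieSU (Fin 2)) (⟨p.src.shift p.ν, p.μ⟩ : PBond (F.P Kt) 0) - ContinuousLinearMap.proj (R := ℝ) (φ := fun _ : PBond (F.P Kt) 0 => lieSU (Fin 2)) (⟨p.src, p.ν⟩ : PBond (F.P Kt) 0) : (PBond (F.P Kt) 0 → lieSU (Fin 2)) →L[ℝ] lieSU (Fin 2))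
                (ContinuousLinearMap.proj (R := ℝ) (φ := fun _ : PBond (F.P Kt) 0 => lieSU (Fin 2)) (⟨p.src, p.μ⟩ : PBond (F.P Kt) 0) + ContinuousLinearMap.proj (R := ℝ) (φ := fun _ : PBond (F.P Kt) 0 => lieSU (Fin 2)) (⟨p.src.shift p.μ, p.ν⟩ : PBond (F.P Kt) 0)
                  - ContinuousLinearMap.proj (R := ℝ) (φ := fun _ : PBond (F.P Kt) 0 => lieSU (Fin 2)) (⟨p.src.shift p.ν, p.μ⟩ : PBond (F.P Kt) 0) - ContinuousLinearMap.proj (R := ℝ) (φ := fun _ : PBond (F.P Kt) 0 => lieSU (Fin 2)) (⟨p.src, p.ν⟩ : PBond (F.P Kt) 0) : (PBond (F.P Kt) 0 → lieSU (Fin 2)) →L[ℝ] lieSU (Fin 2))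
                : (PBond (F.P Kt) 0 → lieSU (Fin 2)) →L[ℝ] (PBond (F.P Kt) 0 → lieSU (Fin 2)) →L[ℝ] ℝ) (fderiv ℝ Xf 0 X) (fderiv ℝ Xf 0 X) := by
  choose C ρ Kτ ρτ ρ'' hC hρ hKτ hρτ hρ'' hh using fun i => exists_hWD_chartHalf_of_class_uniform_l1 (F := F) Kt h0 (hk0 i) (hk i)
  exact ⟨C, ρ, Kτ, ρτ, ρ'', hC, hρ, hKτ, hρτ, hρ'', hh⟩


end Summit.QuantumFields.YangMills.BalabanUVNodes.N12DirectChartPackageOfClassL1Family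

end
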